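import Literature.MathematicalPhysics.QuantumFieldTheory.Balaban1983to89.B9CubeLettersCovarianceL0
import Literature.MathematicalPhysics.QuantumFieldTheory.Balaban1983to89.B9CubeIndexBondsNearH

/-!
# `Balaban1983to89.B9CubeBondRowAgreement` — THE BOND-SECTOR ROW AGREEMENT OF THE CUBE-LOCAL LETTERS WITH THE MEMBER'S (Sect. C p. 414):
# `(Q*_□(U)a_□Q_□(U)A)(f) = (Q*(U)aQ(U)A)(f)` AT EVERY FINE BOND `f` WHOSE AVERAGING STENCIL SEES THE SAME INDEX BONDS IN BOTH SEQUENCES (e.g. near □),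
# FOR EVERY `U`, hence `Δ_{a,□}(U)A − Δ_a(U)A = D_U(R_□(U) − R(U))D*_UA` ON SUCH ROWS — the averaging input behind print's (3.105)
# (sub-row G-B9-LETTERS, module M5.1c PART 2 (P2); lead g29 RULING #5: «deliverable = row agreement of Δ_{a,□}(U) with Δ_a(U) near □»)

FRAMING (verbatim cell line):
statement-level skeleton of published theorems with citation tags; proofs where landed; nothing here is a claim about the Yang–Mills mass gap

Sources under audit (cell lit-balaban): T. Bałaban, *Propagators for lattice gauge theories in a background field*, Commun. Math. Phys. **99**
(1985) 389–434 [`Balaban1985BackgroundPropagators`, "B9"], (3.12)–(3.14) pp. 392–393, (3.26) p. 395, p. 409 l. 3–5, (3.102)–(3.105) p. 414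
(«We have DRD* = DD* − DPD*. … Similarly for averaging operators … Δ_aG₀ = I − Σ_□K(h_□)G_□h_□ − Σ_□(1 − ζ_□̃)DPD*h_□G_□h_□ −
Σ_□ζ_□̃(DPD* − DP_□D*)h_□G_□h_□ − Σ_□ζ_□̃P_{□,1}(∂h_□)G_□h_□ = I − R (3.105)»); T. Bałaban, *Propagators and renormalization transformations for
lattice gauge theories. II*, Commun. Math. Phys. **96** (1984) 223–250 [`Balaban1984PropagatorsII`, "[4]"], (2.3) p. 224, (2.16)–(2.20)
pp. 225–226.  Held text `paper:balaban1985-cmp99-background-propagators` p0026 (p. 414, read on the x2 render).  Unit `lit-balaban-r05` (r05 gen 80).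

## WHAT IS PRINTED AND WHAT IS SILENT

Print builds `G_□(U)` from the operators of the cube sequence `{Ω_n(□)}` (p. 409) and expands `Δ_aG₀`, `G₀ = Σ_□h_□G_□h_□`, in (3.105) p. 414:
the difference `Δ_a − Δ_{a,□}` appears there ONLY through the non-local projection term `DPD* − DP_□D*` (`DRD* = DD* − DPD*`); the Hessian
`Δ(U)` is the same operator in both, and the averaging term `Q*(U)aQ(U)` of the cube sequence AGREES with the member's on the rows that `h_□` sees —
print treats this silently («Similarly for averaging operators» concerns only the commutator with `h`).  This file is that silent step, exactly.

## WHAT THIS FILE CERTIFIES (theorems only; kernel-checked; `U`, the contour transporters `parB` and the argument `A` ARBITRARY)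

§1 `qKc_eq_qK`, `qTc_eq_qT` — on a pair `(j, c)` that is an index bond of BOTH sequences the `Q`-kernel entry and the transporter coincide (they depend
on `(j, c)` and the fine bond only); `summand_eq` — so does the whole `(j, c)`-summand of `(Q*aQA)(f)` (weights by `B9CubeBondWeights.wCubeBond_eq_of_lamBond`).
§2 ★★ `QsaQCubeY_apply_eq` — **THE ROW AGREEMENT**: if every index bond of the cube sequence whose `Q`-entry at `f` is non-zero is an index bond of
the member and conversely (`h1`, `h2`), then `(Q*_□(U)a_□Q_□(U)A)(f) = (Q*(U)aQ(U)A)(f)` (a bijection of the non-vanishing summands,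
`Finset.sum_bij_ne_zero`); ★ `QsaQCubeY_apply_eq_of_nearH` — the hypotheses hold when those index bonds have `NearH □` base points
(`B9CubeIndexBondsNearH.lamBond_domCube_iff_of_nearH`).
§3 ★ `deltaACubeY_sub_deltaAY` — THE EXACT SPLIT `Δ_{a,□}(U) − Δ_a(U) = D_U(R_□(U) − R(U))D*_U + (Q*_□a_□Q_□ − Q*aQ)(U)` (the Hessians cancel),
for ANY site-sector slot `Gp` of the member's `Δ_a(U)`; ★★ `deltaACubeY_sub_deltaAY_apply_eq` — on the rows of §2 the averaging bracket drops:
`(Δ_{a,□}(U)A)(f) − (Δ_a(U)A)(f) = (D_U(R_□(U) − R(U))D*_UA)(f)` — print's `DPD* − DP_□D*` term of (3.105), and nothing else.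

## HONEST SCOPE

* Exact algebra; no inequality; the geometric discharge «`supp h_□` and the stencil of `Q` at its bonds lie in `NearH □`» is NOT here (inputs:
  `B9CubeCutoffNearH.nearH_of_hT_ne_zero` for the sites of `supp h_□`; the stencil margin is the consumer's, cf. p38's `B9Eq3104CommutatorSupport`).
  Nothing is said about `R_□(U) − R(U)` beyond the identity (it is print's (3.105) third term, estimated by (3.49), not here).
* Nothing is inferred from the manuscript; kernel-checked; 0 definitions, 0 facts.  NOT summit progress; the YM mass gap is not proved by any of this.
-/

namespace Literature.MathematicalPhysics.QuantumFieldTheory.Balaban1983to89.B9CubeBondRowAgreement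

open LatticeFieldCalculus
open Node00
open Literature.MathematicalPhysics.QuantumFieldTheory.Balaban1983to89.B6KLevelCensusIndexV1 (KIdx)
open Literature.MathematicalPhysics.QuantumFieldTheory.Balaban1983to89.B6Cover236MultiLevelBlocks (cubes)
open Literature.MathematicalPhysics.QuantumFieldTheory.Balaban1983to89.B6Ineq2133TwoScaleV1 (onFun onFun_apply)
open Literature.MathematicalPhysics.QuantumFieldTheory.Balaban1983to89.B6SectAOperatorsV1 (QE_apply)
open Literature.MathematicalPhysics.QuantumFieldTheory.Balaban1983to89.B6GlobalChartV1 (PV domT toBox)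
open Literature.MathematicalPhysics.QuantumFieldTheory.Balaban1983to89.B15DeterminingSets (embIter)
open Literature.MathematicalPhysics.QuantumFieldTheory.Balaban1983to89.B9Eq39Adjoint (R)
open Literature.MathematicalPhysics.QuantumFieldTheory.Balaban1983to89.B9CubeSequence408 (NearH)
open Literature.MathematicalPhysics.QuantumFieldTheory.Balaban1983to89.B9CubeBondWeights (domCube wCubeBond wCubeBond_eq_of_lamBond)
open Literature.MathematicalPhysics.QuantumFieldTheory.Balaban1983to89.B9CubeIndexBondsNearH (lamBond_domCube_iff_of_nearH)
open Literature.MathematicalPhysics.QuantumFieldTheory.Balaban1983to89.B9CubeLettersCovarianceL0 (qsKc_eq_transpose aKc_eq_diagonal)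
open Literature.MathematicalPhysics.QuantumFieldTheory.Balaban1983to89.B9CubeLettersBondOpsL0
open scoped Matrix

noncomputable section

variable {d ℓ : ℕ} {hd : 1 ≤ d + 1} {hL : Odd (ℓ + 1) ∧ 1 < ℓ + 1} {b₀ b₁ : ℝ}
variable {𝔸 : Type} [NormedRing 𝔸] [NormedAlgebra ℂ 𝔸] [CompleteSpace 𝔸]
variable (i : KIdx d ℓ hd hL b₀ b₁) (q : ↥(cubes (toKT i).D.toDomains))

/-! ## §1 On common index bonds the kernels, transporters and summands coincide -/

/-- the `Q`-kernel entry of a pair `(j, c)` that is an index bond of both sequences is the same number (it depends on `(j, c)` and the fine bond only).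
[cite: Balaban1985BackgroundPropagators, (3.12)–(3.14) pp.392–393; Balaban1984PropagatorsII, (2.20) p.226] -/
theorem qKc_eq_qK (p : (j : Fin (i.k + 1)) × PBond (PV d ℓ i.m i.K hd hL) (j : ℕ)) (hF : (domCube i q).LamBond (p.1 : ℕ) p.2)
    (hD : (domT i.hN i.D i.hk).LamBond (p.1 : ℕ) p.2) (b : FBondY i) : qKc i q ⟨p, hF⟩ b = qK i ⟨p, hD⟩ b := by
  rw [qKc, qK, LinearMap.toMatrix'_apply, LinearMap.toMatrix'_apply, onFun_apply, onFun_apply, QE_apply, QE_apply]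

/-- the `Q`-transporters coincide likewise (same formula). [cite: Balaban1985BackgroundPropagators, (3.12)–(3.14) pp.392–393, bookkeeping] -/
theorem qTc_eq_qT (parB : BondParY 𝔸 i) (U : CfgY 𝔸 i) (p : (j : Fin (i.k + 1)) × PBond (PV d ℓ i.m i.K hd hL) (j : ℕ))
    (hF : (domCube i q).LamBond (p.1 : ℕ) p.2) (hD : (domT i.hN i.D i.hk).LamBond (p.1 : ℕ) p.2) (b : FBondY i) :
    qTc i q parB U ⟨p, hF⟩ b = qT i parB U ⟨p, hD⟩ b := rfl

/-- the normal form of `(Q*_□(U)a_□Q_□(U)A)(f)`: a sum over the cube sequence's index bonds. [cite: Balaban1985BackgroundPropagators, (3.12)–(3.14) pp.392–393, (3.26) p.395, p.409 l.3–5, bookkeeping] -/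
theorem QsaQCubeY_apply (parB : BondParY 𝔸 i) (U : CfgY 𝔸 i) (A : FBondY i → 𝔸) (f : FBondY i) :
    QsCubeY i q parB U (aCubeY i q (QCubeY i q parB U A)) f =
      ∑ ι : IBondCubeY i q, ((qKc i q ι f : ℝ) : ℂ) • R ((qTc i q parB U ι f)⁻¹)
        ((((wCubeBond i q ι : ℝ) : ℂ)) • ∑ f', ((qKc i q ι f' : ℝ) : ℂ) • R (qTc i q parB U ι f') (A f')) := by
  rw [QsCubeY, trLiftY_apply]
  refine Finset.sum_congr rfl fun ι _ => ?_
  rw [qsKc_eq_transpose, Matrix.transpose_apply, aCubeY, aKc_eq_diagonal, liftMatY_diagonal_apply, QCubeY, trLiftY_apply]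

/-- the normal form of the member's `(Q*(U)aQ(U)A)(f)`. [cite: Balaban1985BackgroundPropagators, (3.12)–(3.14) pp.392–393, (3.26) p.395, bookkeeping] -/
theorem QsaQY_apply (parB : BondParY 𝔸 i) (U : CfgY 𝔸 i) (A : FBondY i → 𝔸) (f : FBondY i) :
    QsY i parB U (aY i (QY i parB U A)) f =
      ∑ ι : IBondY i, ((qK i ι f : ℝ) : ℂ) • R ((qT i parB U ι f)⁻¹)
        ((((i.w ι : ℝ) : ℂ)) • ∑ f', ((qK i ι f' : ℝ) : ℂ) • R (qT i parB U ι f') (A f')) := by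
  rw [QsY, trLiftY_apply]
  refine Finset.sum_congr rfl fun ι _ => ?_
  rw [qsK_eq_transpose, Matrix.transpose_apply, aY, aK_eq_diagonal, liftMatY_diagonal_apply, QY, trLiftY_apply]

/-- on a common index bond the whole summand coincides (weights by `wCubeBond_eq_of_lamBond`). [cite: Balaban1985BackgroundPropagators, p.409 l.3–5 («constructed for this sequence»); Balaban1984PropagatorsII, (2.14) p.225, (2.20) p.226 («Q*aQ is defined by a formula similar to (2.14) with a_j replaced simply by a»)] -/
theorem summand_eq (parB : BondParY 𝔸 i) (U : CfgY 𝔸 i) (A : FBondY i → 𝔸) (f : FBondY i)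
    (p : (j : Fin (i.k + 1)) × PBond (PV d ℓ i.m i.K hd hL) (j : ℕ)) (hF : (domCube i q).LamBond (p.1 : ℕ) p.2)
    (hD : (domT i.hN i.D i.hk).LamBond (p.1 : ℕ) p.2) :
    ((qKc i q ⟨p, hF⟩ f : ℝ) : ℂ) • R ((qTc i q parB U ⟨p, hF⟩ f)⁻¹)
        ((((wCubeBond i q ⟨p, hF⟩ : ℝ) : ℂ)) • ∑ f', ((qKc i q ⟨p, hF⟩ f' : ℝ) : ℂ) • R (qTc i q parB U ⟨p, hF⟩ f') (A f')) =
      ((qK i ⟨p, hD⟩ f : ℝ) : ℂ) • R ((qT i parB U ⟨p, hD⟩ f)⁻¹)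
        ((((i.w ⟨p, hD⟩ : ℝ) : ℂ)) • ∑ f', ((qK i ⟨p, hD⟩ f' : ℝ) : ℂ) • R (qT i parB U ⟨p, hD⟩ f') (A f')) := by
  rw [wCubeBond_eq_of_lamBond i q ⟨p, hF⟩ hD]
  simp only [qKc_eq_qK i q p hF hD]
  rfl

/-! ## §2 The row agreement of `Q*(U)aQ(U)` -/

/-- ★★ **THE BOND-SECTOR ROW AGREEMENT**: if the index bonds seeing the fine bond `f` are the same in both sequences, then
`(Q*_□(U)a_□Q_□(U)A)(f) = (Q*(U)aQ(U)A)(f)` — for every configuration `U`, every contour transporter table and every `A`.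
[cite: Balaban1985BackgroundPropagators, p.409 l.3–5, (3.105) p.414 («Similarly for averaging operators»); Balaban1984PropagatorsII, (2.3) p.224, (2.20) p.226] -/
theorem QsaQCubeY_apply_eq (parB : BondParY 𝔸 i) (U : CfgY 𝔸 i) (A : FBondY i → 𝔸) (f : FBondY i)
    (h1 : ∀ ι : IBondCubeY i q, qKc i q ι f ≠ 0 → (domT i.hN i.D i.hk).LamBond (ι.1.1 : ℕ) ι.1.2)
    (h2 : ∀ ι : IBondY i, qK i ι f ≠ 0 → (domCube i q).LamBond (ι.1.1 : ℕ) ι.1.2) :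
    QsCubeY i q parB U (aCubeY i q (QCubeY i q parB U A)) f = QsY i parB U (aY i (QY i parB U A)) f := by
  classical
  rw [QsaQCubeY_apply, QsaQY_apply]
  -- the non-vanishing summands are in bijection `ι ↦ ⟨ι.1, _⟩`
  have hne1 : ∀ ι : IBondCubeY i q,
      ((qKc i q ι f : ℝ) : ℂ) • R ((qTc i q parB U ι f)⁻¹)
        ((((wCubeBond i q ι : ℝ) : ℂ)) • ∑ f', ((qKc i q ι f' : ℝ) : ℂ) • R (qTc i q parB U ι f') (A f')) ≠ 0 → qKc i q ι f ≠ 0 := by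
    intro ι hne h0
    apply hne
    rw [h0, Complex.ofReal_zero, zero_smul]
  have hne2 : ∀ ι : IBondY i,
      ((qK i ι f : ℝ) : ℂ) • R ((qT i parB U ι f)⁻¹)
        ((((i.w ι : ℝ) : ℂ)) • ∑ f', ((qK i ι f' : ℝ) : ℂ) • R (qT i parB U ι f') (A f')) ≠ 0 → qK i ι f ≠ 0 := by
    intro ι hne h0
    apply hne
    rw [h0, Complex.ofReal_zero, zero_smul]
  refine Finset.sum_bij_ne_zero (fun ι _ hne => (⟨ι.1, h1 ι (hne1 ι hne)⟩ : IBondY i)) (fun _ _ _ => Finset.mem_univ _)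
    (fun ι₁ _ _ ι₂ _ _ heq => by have h := Subtype.ext_iff.1 heq; exact Subtype.ext h) (fun ι' _ hne' => ?_) (fun ι _ hne => ?_)
  · -- surjectivity onto the non-vanishing summands of the member
    have hF : (domCube i q).LamBond (ι'.1.1 : ℕ) ι'.1.2 := h2 ι' (hne2 ι' hne')
    refine ⟨⟨ι'.1, hF⟩, Finset.mem_univ _, ?_, rfl⟩
    rw [summand_eq i q parB U A f ι'.1 hF ι'.2]
    exact hne'
  · exact summand_eq i q parB U A f ι.1 ι.2 (h1 ι (hne1 ι hne))

/-- the hypotheses of the row agreement from the `NearH` bookkeeping: if the base points of the endpoints of every index bond (of either sequence) seeing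
`f` are near □, the index bonds agree (`B9CubeIndexBondsNearH.lamBond_domCube_iff_of_nearH`). [cite: Balaban1985BackgroundPropagators, p.408 (Ω_n(□) ⊂ Ω_n by construction: «Ω_{j+1}(□) = □̃³ ∩ B^{j+1}(Λ_{j+1})», «Ω₀(□) ⊂ □̃⁵»), p.409 l.3–5; Balaban1984PropagatorsII, (2.3) p.224] -/
theorem rows_agree_of_nearH (f : FBondY i)
    (hC : ∀ ι : IBondCubeY i q, qKc i q ι f ≠ 0 →
      NearH q (toBox i.hN (embIter (ι.1.1 : ℕ) ι.1.2.src)).1 ∧ NearH q (toBox i.hN (embIter (ι.1.1 : ℕ) ι.1.2.tgt)).1)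
    (hD : ∀ ι : IBondY i, qK i ι f ≠ 0 →
      NearH q (toBox i.hN (embIter (ι.1.1 : ℕ) ι.1.2.src)).1 ∧ NearH q (toBox i.hN (embIter (ι.1.1 : ℕ) ι.1.2.tgt)).1) :
    (∀ ι : IBondCubeY i q, qKc i q ι f ≠ 0 → (domT i.hN i.D i.hk).LamBond (ι.1.1 : ℕ) ι.1.2) ∧
      (∀ ι : IBondY i, qK i ι f ≠ 0 → (domCube i q).LamBond (ι.1.1 : ℕ) ι.1.2) := by
  refine ⟨fun ι hι => ?_, fun ι hι => ?_⟩
  · have hj : (ι.1.1 : ℕ) ≤ i.k := Nat.lt_succ_iff.1 ι.1.1.2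
    exact (lamBond_domCube_iff_of_nearH i q hj ι.1.2 (hC ι hι).1 (hC ι hι).2).1 ι.2
  · have hj : (ι.1.1 : ℕ) ≤ i.k := Nat.lt_succ_iff.1 ι.1.1.2
    exact (lamBond_domCube_iff_of_nearH i q hj ι.1.2 (hD ι hι).1 (hD ι hι).2).2 ι.2

/-- ★ **THE ROW AGREEMENT NEAR □**: `(Q*_□(U)a_□Q_□(U)A)(f) = (Q*(U)aQ(U)A)(f)` whenever every index bond seeing `f` has `NearH □` base points.
[cite: Balaban1985BackgroundPropagators, p.409 l.3–5, (3.105) p.414; Balaban1984PropagatorsII, (2.3) p.224, (2.20) p.226] -/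
theorem QsaQCubeY_apply_eq_of_nearH (parB : BondParY 𝔸 i) (U : CfgY 𝔸 i) (A : FBondY i → 𝔸) (f : FBondY i)
    (hC : ∀ ι : IBondCubeY i q, qKc i q ι f ≠ 0 →
      NearH q (toBox i.hN (embIter (ι.1.1 : ℕ) ι.1.2.src)).1 ∧ NearH q (toBox i.hN (embIter (ι.1.1 : ℕ) ι.1.2.tgt)).1)
    (hD : ∀ ι : IBondY i, qK i ι f ≠ 0 →
      NearH q (toBox i.hN (embIter (ι.1.1 : ℕ) ι.1.2.src)).1 ∧ NearH q (toBox i.hN (embIter (ι.1.1 : ℕ) ι.1.2.tgt)).1) :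
    QsCubeY i q parB U (aCubeY i q (QCubeY i q parB U A)) f = QsY i parB U (aY i (QY i parB U A)) f :=
  QsaQCubeY_apply_eq i q parB U A f (rows_agree_of_nearH i q f hC hD).1 (rows_agree_of_nearH i q f hC hD).2

/-! ## §3 `Δ_{a,□}(U) − Δ_a(U)`: the exact split and its rows near □ -/

/-- ★ **THE EXACT SPLIT**: `Δ_{a,□}(U) − Δ_a(U) = D_U(R_□(U) − R(U))D*_U + (Q*_□a_□Q_□ − Q*aQ)(U)` — the Hessians `Δ(U)` cancel; `Gp` is whatever
site-sector letter the member's `Δ_a(U)` carries (def-Y's `G′(U)` slot). [cite: Balaban1985BackgroundPropagators, (3.26) p.395, (3.105) p.414 («DRD* = DD* − DPD*», the `DPD* − DP_□D*` term)] -/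
theorem deltaACubeY_sub_deltaAY (parS : SiteParY 𝔸 i) (parB : BondParY 𝔸 i) (Gp : SiteOpY 𝔸 i) (U : CfgY 𝔸 i) :
    deltaACubeY i q parS parB U - deltaAY i parS parB Gp U =
      gradY i U ∘ₗ (RCubeY i q parS U - RY i parS Gp U) ∘ₗ divY i U +
        (QsCubeY i q parB U ∘ₗ aCubeY i q ∘ₗ QCubeY i q parB U - QsY i parB U ∘ₗ aY i ∘ₗ QY i parB U) := by
  rw [deltaACubeY, deltaAY, LinearMap.sub_comp, LinearMap.comp_sub]
  abel

/-- ★★ **ON THE ROWS WHERE THE INDEX BONDS AGREE, ONLY THE PROJECTION TERM SURVIVES**: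
`(Δ_{a,□}(U)A)(f) − (Δ_a(U)A)(f) = (D_U(R_□(U) − R(U))D*_UA)(f)` — print's `DPD* − DP_□D*` term of (3.105) (with `R = I − P`), exactly.
[cite: Balaban1985BackgroundPropagators, (3.105) p.414, (3.26) p.395, p.409 l.3–5] -/
theorem deltaACubeY_sub_deltaAY_apply_eq (parS : SiteParY 𝔸 i) (parB : BondParY 𝔸 i) (Gp : SiteOpY 𝔸 i) (U : CfgY 𝔸 i)
    (A : FBondY i → 𝔸) (f : FBondY i)
    (h1 : ∀ ι : IBondCubeY i q, qKc i q ι f ≠ 0 → (domT i.hN i.D i.hk).LamBond (ι.1.1 : ℕ) ι.1.2)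
    (h2 : ∀ ι : IBondY i, qK i ι f ≠ 0 → (domCube i q).LamBond (ι.1.1 : ℕ) ι.1.2) :
    deltaACubeY i q parS parB U A f - deltaAY i parS parB Gp U A f =
      gradY i U ((RCubeY i q parS U - RY i parS Gp U) (divY i U A)) f := by
  have h := LinearMap.congr_fun (deltaACubeY_sub_deltaAY i q parS parB Gp U) A
  rw [LinearMap.sub_apply] at h
  rw [← Pi.sub_apply, h, LinearMap.add_apply, Pi.add_apply, LinearMap.sub_apply, Pi.sub_apply]
  simp only [LinearMap.comp_apply]
  rw [QsaQCubeY_apply_eq i q parB U A f h1 h2, sub_self, add_zero]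

/-- ★ the same near □ (`NearH` base points of every index bond seeing `f`). [cite: Balaban1985BackgroundPropagators, (3.105) p.414, p.408–409] -/
theorem deltaACubeY_sub_deltaAY_apply_eq_of_nearH (parS : SiteParY 𝔸 i) (parB : BondParY 𝔸 i) (Gp : SiteOpY 𝔸 i) (U : CfgY 𝔸 i)
    (A : FBondY i → 𝔸) (f : FBondY i)
    (hC : ∀ ι : IBondCubeY i q, qKc i q ι f ≠ 0 →
      NearH q (toBox i.hN (embIter (ι.1.1 : ℕ) ι.1.2.src)).1 ∧ NearH q (toBox i.hN (embIter (ι.1.1 : ℕ) ι.1.2.tgt)).1)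
    (hD : ∀ ι : IBondY i, qK i ι f ≠ 0 →
      NearH q (toBox i.hN (embIter (ι.1.1 : ℕ) ι.1.2.src)).1 ∧ NearH q (toBox i.hN (embIter (ι.1.1 : ℕ) ι.1.2.tgt)).1) :
    deltaACubeY i q parS parB U A f - deltaAY i parS parB Gp U A f =
      gradY i U ((RCubeY i q parS U - RY i parS Gp U) (divY i U A)) f :=
  deltaACubeY_sub_deltaAY_apply_eq i q parS parB Gp U A f (rows_agree_of_nearH i q f hC hD).1 (rows_agree_of_nearH i q f hC hD).2

end

end Literature.MathematicalPhysics.QuantumFieldTheory.Balaban1983to89.B9CubeBondRowAgreement
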